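import Summits.BirchSwinnertonDyer.BirchSwinnertonDyer.Theorems.AlignedTransportAtTwoMainConjectureTransportAlignedAtTwoBothAddSymbol
import Literature.NumberTheory.EllipticCurves.PAdicLFunctionTameProofs
import Literature.NumberTheory.EllipticCurves.PAdicLFunctionIntegralityAtTwoAutoProofs
import Literature.NumberTheory.EllipticCurves.PAdicLFunctionTameCongruenceProofs
import HarnessLib

/-!
# Route `AlignedTransportAtTwo`, crux C1 `MainConjectureTransportAlignedAtTwo` (stmt-BirchSwinnertonDyer-22296), line `birth` —
# the BOTH-ADDITIVE twist leg, part 2 (MEASURE): at a tame level `u = ℓ·m` with `ℓ² ∣ N`, `(m, N) = 1`, the cells of the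
# Mazur–Swinnerton-Dyer measure `μ_{f,α,u}` are `½ℤ`-combinations PLUS class representatives `[c/ℓ]⁺`; the `(χ − 𝟙_u)`-isotypic
# cell sums have `2`-adic norm `≤ 1`

HONEST FRAMING (cell `bsd-f1-sign2`, lead seat `bsd-line-att-p1` g8). BSD is NOT proved; C1 is NOT closed. THEOREMS ONLY about the tame measure of
a weight-2 cusp form (nothing asserted); `--supports stmt-BirchSwinnertonDyer-22296 --as helper`. Part 1: `…BothAddSymbol`.

For `N` odd with `ℓ² ∣ N` (`ℓ` an odd prime: an ADDITIVE prime of the curve, `a_ℓ = 0`) and a tame level `u = ℓ·m`, `(m, 2N) = 1`, the tame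
fraction `x = c/(2ⁿ⁺¹u)` of a cell `((a + 2ⁿ⁺¹ℤ₂) × {b})` with `a` odd and `b` a unit has `gcd(den x, N) = ℓ` and lies in the cusp class
`c·2ⁿ⁺¹m ≡ b·2ⁿ⁺¹m (mod ℓ)` of `X₀(N)` (part 1 §1); likewise `2x` lies in the class `b·2ⁿm`. So
`[x]⁺ = [b·t₁/ℓ]⁺ + k₁/2`, `[2x]⁺ = [b·t₂/ℓ]⁺ + k₂/2` (§1–§2). The representatives `[b·t/ℓ]⁺` depend on `b mod ℓ` only: they CANCEL in
a sum weighted by a character `χ` mod `u` non-trivial on the units `≡ 1 (mod ℓ)` (shift lemma), and over the units they add up to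
`−φ(m)·[0]⁺` (CRT × the `U_ℓ`-relation with `a_ℓ = 0`), §3. Consequence (§4): for `χ` quadratic with such a witness `h₀`,
`‖Σ_b (χ(b) − 𝟙_u(b))·μ_{f,α,u}((a + 2ⁿ⁺¹ℤ₂) × {b})‖₂ ≤ 1` — the `½`-parts carry the even coefficients `χ(b) − 1 ∈ {0, −2}`, and the
representative part is `φ(m)·α⁻ⁿ⁻²(α − 1)[0]⁺` with `φ(m)` even and `‖(α − 1)[0]⁺‖ ≤ 2` (INT2-AUTO). This is the cell estimate behind
`L₂(f,α,χ) ≡ L₂(f,α,𝟙_u) (mod 2Λ)` at a tame level through an additive prime (part 3), where the tree's cell-wise bound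
`norm_msdMeasureTame_two_le_two_sqfreeAt` (which needs `ℓ² ∤ N`) is not available.

References: [MazurTateTeitelbaum1986Invent] §I.4 (4.2), §I.8, §I.10 (10.1); [Matsuno2000] §2, Lemma 3.2; [CremonaAlgorithms1997] §2.2, §2.8.
-/

set_option autoImplicit false
set_option linter.dupNamespace false

noncomputable section

open scoped Classical MatrixGroups ModularForm

open CongruenceSubgroup Literature.NumberTheory.EllipticCurves Literature.NumberTheory.EllipticCurves.ModularForms
open Summit.BirchSwinnertonDyer.BirchSwinnertonDyer.Theorems.AlignedTransportAtTwoBothAddSymbol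

namespace Summit.BirchSwinnertonDyer.BirchSwinnertonDyer.Theorems.AlignedTransportAtTwoBothAddMeasure

variable {N : ℕ} [NeZero N] (f : CuspForm (Gamma0 N) 2) {ℓ m : ℕ} [NeZero (ℓ * m)]

/-! ## §1 The cusp classes of the tame fractions at level `ℓ·m` -/

/-- **The tame fraction `x = c/(2ⁿ⁺¹ℓm)` of a cell with `a` odd and `b` a unit lies in the class `b·2ⁿ⁺¹m (mod ℓ)`, and `2x` in the class
`b·2ⁿm`**: `{∞, x} − {∞, b·2ⁿ⁺¹m/ℓ} ∈ Λ_f` and `{∞, 2x} − {∞, b·2ⁿm/ℓ} ∈ Λ_f` (`N = ℓ²M` odd, `(m, N) = 1`, `m` odd; part 1 §1 with `A = c`,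
`C' = 2ⁿ⁺¹m` resp. `2ⁿm`, then `c ≡ b (mod ℓ)`). [cite: CremonaAlgorithms1997, §2.2 Lemma 2.2.3] [cite: MazurTateTeitelbaum1986Invent, §I.10 (10.1)] -/
theorem sub_mem_periodLattice_tameFraction (hℓ : ℓ.Prime) (hℓN : ℓ ^ 2 ∣ N) (h2N : ¬ 2 ∣ N) (hmN : m.Coprime N)
    (hm2 : ¬ 2 ∣ m) (n : ℕ) {a : ZMod (2 ^ (n + 1))} (ha : IsUnit a) {b : ZMod (ℓ * m)} (hb : IsUnit b) :
    modularSymbol f (tameFraction 2 (ℓ * m) (n + 1) a b) -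
        modularSymbol f ((((b.val : ℤ) * (2 ^ (n + 1) * m : ℕ) : ℤ) : ℚ) / (ℓ : ℤ)) ∈ periodLattice f ∧
      modularSymbol f ((2 : ℚ) * tameFraction 2 (ℓ * m) (n + 1) a b) -
        modularSymbol f ((((b.val : ℤ) * (2 ^ n * m : ℕ) : ℤ) : ℚ) / (ℓ : ℤ)) ∈ periodLattice f := by
  obtain ⟨M, hM⟩ := hℓN
  have hℓ0 : (ℓ : ℤ) ≠ 0 := by exact_mod_cast hℓ.ne_zero
  have hm0 : m ≠ 0 := fun h ↦ by simp [h] at hm2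
  have hℓ2 : ℓ ≠ 2 := by
    rintro rfl; exact h2N (dvd_trans ⟨2, by norm_num⟩ ⟨M, hM⟩)
  have hℓm2 : (ℓ * m).Coprime 2 :=
    Nat.Coprime.mul_left ((Nat.coprime_primes hℓ Nat.prime_two).mpr hℓ2)
      ((Nat.Prime.coprime_iff_not_dvd Nat.prime_two).mpr hm2).symm
  have hℓQ' : (ℓ : ℚ) ≠ 0 := by exact_mod_cast hℓ.ne_zero
  set c : ℕ := tameRep 2 (ℓ * m) (n + 1) a b with hc
  -- `c ≡ a (mod 2ⁿ⁺¹)`: `c` is odd; `c ≡ b (mod ℓm)`: `gcd(c, m) = 1` and `ℓ ∣ c − b`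
  have hca : ((c : ℕ) : ZMod (2 ^ (n + 1))) = a := natCast_tameRep_left Nat.prime_two hℓm2 a b
  have hcb : ((c : ℕ) : ZMod (ℓ * m)) = b := natCast_tameRep_right hℓm2 a b
  have hcodd : ¬ 2 ∣ c := by
    intro h2c
    have hu : IsUnit ((c : ℕ) : ZMod (2 ^ (n + 1))) := by rw [hca]; exact ha
    rw [ZMod.isUnit_iff_coprime, Nat.coprime_pow_right_iff (Nat.succ_pos n), Nat.coprime_comm,
      Nat.Prime.coprime_iff_not_dvd Nat.prime_two] at hu
    exact hu h2c
  have hcu : Nat.Coprime c (ℓ * m) := by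
    have hu : IsUnit ((c : ℕ) : ZMod (ℓ * m)) := by rw [hcb]; exact hb
    exact (ZMod.isUnit_iff_coprime c (ℓ * m)).mp hu
  have hcm : Nat.Coprime c m := Nat.Coprime.coprime_mul_left_right hcu
  have hℓcb : (ℓ : ℤ) ∣ (c : ℤ) - (b.val : ℤ) := by
    have h1 : ((c : ℕ) : ZMod (ℓ * m)) = ((b.val : ℕ) : ZMod (ℓ * m)) := by rw [hcb, ZMod.natCast_zmod_val]
    have h2 := (ZMod.natCast_eq_natCast_iff' _ _ _).mp h1
    have h3 : (c : ℤ) % (ℓ * m : ℕ) = (b.val : ℤ) % (ℓ * m : ℕ) := by exact_mod_cast h2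
    have h4 : ((ℓ * m : ℕ) : ℤ) ∣ (c : ℤ) - b.val := Int.ModEq.dvd h3.symm |> fun h ↦ by
      simpa [dvd_sub_comm] using h
    exact dvd_trans ⟨m, by push_cast; ring⟩ h4
  -- coprimality of `C' = 2ᵏ m` with `ℓ M c`
  have hcopZ : ∀ k : ℕ, IsCoprime ((2 ^ k * m : ℕ) : ℤ) ((ℓ : ℤ) * M * c) := by
    intro k
    have h1 : Nat.Coprime (2 ^ k * m) (ℓ * M) := by
      refine Nat.Coprime.coprime_dvd_right (⟨ℓ, by rw [hM]; ring⟩ : ℓ * M ∣ N) ?_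
      exact Nat.Coprime.mul_left (Nat.Coprime.pow_left k ((Nat.Prime.coprime_iff_not_dvd Nat.prime_two).mpr h2N)) hmN
    have h2 : Nat.Coprime (2 ^ k * m) c :=
      Nat.Coprime.mul_left (Nat.Coprime.pow_left k ((Nat.Prime.coprime_iff_not_dvd Nat.prime_two).mpr hcodd)) hcm.symm
    have h3 : Nat.Coprime (2 ^ k * m) (ℓ * M * c) := Nat.Coprime.mul_right h1 h2
    have h4 := Nat.isCoprime_iff_coprime.mpr h3
    push_cast at h4
    exact h4
  have hN' : (N : ℤ) = (ℓ : ℤ) ^ 2 * M := by rw [hM]; push_cast; ring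
  -- the two fractions in the shape `A/(ℓ C')`
  have hx : tameFraction 2 (ℓ * m) (n + 1) a b = ((c : ℤ) : ℚ) / ((ℓ : ℤ) * ((2 ^ (n + 1) * m : ℕ) : ℤ)) := by
    rw [tameFraction, ← hc]; push_cast; ring
  have h2x : (2 : ℚ) * tameFraction 2 (ℓ * m) (n + 1) a b = ((c : ℤ) : ℚ) / ((ℓ : ℤ) * ((2 ^ n * m : ℕ) : ℤ)) := by
    rw [tameFraction, ← hc]; push_cast
    have h2 : (2 : ℚ) ≠ 0 := two_ne_zero
    field_simp
    ring
  refine ⟨?_, ?_⟩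
  · have h := modularSymbol_div_sub_div_mem_periodLattice_of_sq_dvd f (A := c) (C' := ((2 ^ (n + 1) * m : ℕ) : ℤ))
      (r := (c : ℤ) * (2 ^ (n + 1) * m : ℕ)) (t := 0) hN' hℓ0 (by exact_mod_cast (mul_ne_zero (pow_ne_zero _ two_ne_zero) hm0))
      (hcopZ (n + 1)) (by ring)
    rw [hx]
    have hper : modularSymbol f ((((c : ℤ) * (2 ^ (n + 1) * m : ℕ) : ℤ) : ℚ) / (ℓ : ℤ)) =
        modularSymbol f ((((b.val : ℤ) * (2 ^ (n + 1) * m : ℕ) : ℤ) : ℚ) / (ℓ : ℤ)) := by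
      obtain ⟨k, hk⟩ := hℓcb
      have hℓQ : ((ℓ : ℤ) : ℚ) ≠ 0 := by exact_mod_cast hℓ0
      have : (((c : ℤ) * (2 ^ (n + 1) * m : ℕ) : ℤ) : ℚ) / (ℓ : ℤ) =
          (((b.val : ℤ) * (2 ^ (n + 1) * m : ℕ) : ℤ) : ℚ) / (ℓ : ℤ) + ((k * (2 ^ (n + 1) * m : ℕ) : ℤ) : ℚ) := by
        have hc' : ((c : ℤ) : ℚ) = (b.val : ℤ) + (ℓ : ℤ) * k := by exact_mod_cast (by linear_combination hk : (c:ℤ) = b.val + ℓ * k)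
        push_cast at hc' ⊢
        rw [hc']; field_simp
      rw [this]
      exact_mod_cast modularSymbol_add_intCast_holds f _ (k * (2 ^ (n + 1) * m : ℕ))
    rwa [hper] at h
  · have h := modularSymbol_div_sub_div_mem_periodLattice_of_sq_dvd f (A := c) (C' := ((2 ^ n * m : ℕ) : ℤ))
      (r := (c : ℤ) * (2 ^ n * m : ℕ)) (t := 0) hN' hℓ0 (by exact_mod_cast (mul_ne_zero (pow_ne_zero _ two_ne_zero) hm0))
      (hcopZ n) (by ring)
    rw [h2x]
    have hper : modularSymbol f ((((c : ℤ) * (2 ^ n * m : ℕ) : ℤ) : ℚ) / (ℓ : ℤ)) =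
        modularSymbol f ((((b.val : ℤ) * (2 ^ n * m : ℕ) : ℤ) : ℚ) / (ℓ : ℤ)) := by
      obtain ⟨k, hk⟩ := hℓcb
      have hℓQ : ((ℓ : ℤ) : ℚ) ≠ 0 := by exact_mod_cast hℓ0
      have : (((c : ℤ) * (2 ^ n * m : ℕ) : ℤ) : ℚ) / (ℓ : ℤ) =
          (((b.val : ℤ) * (2 ^ n * m : ℕ) : ℤ) : ℚ) / (ℓ : ℤ) + ((k * (2 ^ n * m : ℕ) : ℤ) : ℚ) := by
        have hc' : ((c : ℤ) : ℚ) = (b.val : ℤ) + (ℓ : ℤ) * k := by exact_mod_cast (by linear_combination hk : (c:ℤ) = b.val + ℓ * k)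
        push_cast at hc' ⊢
        rw [hc']; field_simp
      rw [this]
      exact_mod_cast modularSymbol_add_intCast_holds f _ (k * (2 ^ n * m : ℕ))
    rwa [hper] at h

/-! ## §2 The plus symbols of the tame fractions: representative `+ k/2` -/

/-- **`[x]⁺ = [b·2ⁿ⁺¹m/ℓ]⁺ + k₁/2` and `[2x]⁺ = [b·2ⁿm/ℓ]⁺ + k₂/2`, `kᵢ ∈ ℤ`**, for the tame fraction `x` of a cell `((a + 2ⁿ⁺¹ℤ₂) × {b})` at level
`ℓm` with `a` odd and `b` a unit (real coefficients; §1 read on real parts, part 1 §2). [cite: MazurTateTeitelbaum1986Invent, §I.8 and §I.10 (10.1)] -/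
theorem exists_ratPlusSymbol_tameFraction_eq (hreal : ∀ n, (cuspCoeff f n).im = 0) (hℓ : ℓ.Prime) (hℓN : ℓ ^ 2 ∣ N)
    (h2N : ¬ 2 ∣ N) (hmN : m.Coprime N) (hm2 : ¬ 2 ∣ m) (n : ℕ) {a : ZMod (2 ^ (n + 1))} (ha : IsUnit a)
    {b : ZMod (ℓ * m)} (hb : IsUnit b) :
    ∃ k₁ k₂ : ℤ,
      ratPlusSymbol f (tameFraction 2 (ℓ * m) (n + 1) a b) =
          ratPlusSymbol f ((((b.val : ℤ) * (2 ^ (n + 1) * m : ℕ) : ℤ) : ℚ) / (ℓ : ℤ)) + (k₁ : ℚ) / 2 ∧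
        ratPlusSymbol f ((2 : ℚ) * tameFraction 2 (ℓ * m) (n + 1) a b) =
          ratPlusSymbol f ((((b.val : ℤ) * (2 ^ n * m : ℕ) : ℤ) : ℚ) / (ℓ : ℤ)) + (k₂ : ℚ) / 2 := by
  obtain ⟨h1, h2⟩ := sub_mem_periodLattice_tameFraction f hℓ hℓN h2N hmN hm2 n ha hb
  obtain ⟨k₁, hk₁⟩ := exists_ratPlusSymbol_eq_add_div_two_of_sub_mem f hreal h1
  obtain ⟨k₂, hk₂⟩ := exists_ratPlusSymbol_eq_add_div_two_of_sub_mem f hreal h2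
  exact ⟨k₁, k₂, hk₁, hk₂⟩

/-! ## §3 The representative sums over `b mod ℓm` -/

/-- **The representatives cancel in a `χ`-sum**: `Σ_{b mod ℓm} χ(b)·[b·t/ℓ]⁺ = 0` for a character `χ` mod `ℓm` and a unit `h₀ ≡ 1 (mod ℓ)` with
`χ(h₀) ≠ 1` (`[b·t/ℓ]⁺` depends on `b mod ℓ` only; shift lemma of part 1). [cite: Matsuno2000, §2] -/
theorem sum_char_mul_ratPlusSymbol_rep_eq_zero (hℓ : ℓ ≠ 0) (χ : DirichletCharacter ℚ_[2] (ℓ * m)) (h₀ : (ZMod (ℓ * m))ˣ)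
    (hh₀ : (ℓ : ℤ) ∣ ((h₀ : ZMod (ℓ * m)).val : ℤ) - 1) (hχ : χ h₀ ≠ 1) (t : ℕ) :
    ∑ b : ZMod (ℓ * m), χ b * ((ratPlusSymbol f ((((b.val : ℤ) * t : ℤ) : ℚ) / (ℓ : ℤ)) : ℚ) : ℚ_[2]) = 0 := by
  refine sum_mul_eq_zero_of_shift χ _ h₀ (fun b ↦ ?_) hχ
  have hℓ0 : (ℓ : ℤ) ≠ 0 := by exact_mod_cast hℓ
  congr 1
  refine ratPlusSymbol_div_eq_of_dvd_sub f hℓ0 ?_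
  -- `(b h₀).val ≡ b.val · h₀.val ≡ b.val (mod ℓ)`
  have hmod : (b * (h₀ : ZMod (ℓ * m))).val ≡ b.val * (h₀ : ZMod (ℓ * m)).val [MOD ℓ * m] := by
    rw [ZMod.val_mul]; exact Nat.mod_modEq _ _
  obtain ⟨q, hq⟩ := (Nat.modEq_iff_dvd.mp hmod)
  obtain ⟨e, he⟩ := hh₀
  refine ⟨(b.val : ℤ) * t * e - m * q * t, ?_⟩
  push_cast at hq ⊢
  linear_combination (-(t : ℤ)) * hq + ((b.val : ℤ) * t) * he

/-- The representative `[b·t/ℓ]⁺` of `b mod ℓm` is that of `b mod ℓ`. [folklore] -/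
theorem ratPlusSymbol_rep_eq_rep_cast (hℓ : ℓ ≠ 0) (b : ZMod (ℓ * m)) (t : ℕ) :
    ratPlusSymbol f ((((b.val : ℤ) * t : ℤ) : ℚ) / (ℓ : ℤ)) =
      ratPlusSymbol f (((((ZMod.cast b : ZMod ℓ).val : ℤ) * t : ℤ) : ℚ) / (ℓ : ℤ)) := by
  have hℓ0 : (ℓ : ℤ) ≠ 0 := by exact_mod_cast hℓ
  refine ratPlusSymbol_div_eq_of_dvd_sub f hℓ0 ?_
  have hv : (ZMod.cast b : ZMod ℓ).val = b.val % ℓ := by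
    rw [ZMod.cast_eq_val, ZMod.val_natCast]
  rw [hv]
  have h := Nat.mod_add_div (b.val) ℓ
  refine ⟨(b.val / ℓ : ℕ) * t, ?_⟩
  have h' := congrArg (Nat.cast : ℕ → ℤ) h
  push_cast at h' ⊢
  linear_combination (t : ℤ) * h'.symm

/-- **The representatives over the units add up to `−φ(m)·[0]⁺`**: `Σ_{b mod ℓm} 𝟙_{ℓm}(b)·[b·t/ℓ]⁺ = −φ(m)·[0]⁺` for `(ℓ, m) = 1`, `ℓ ∤ t`,
and a rational newform with `a_ℓ = 0`, `ℓ ∣ N` (Chinese remainder: the units of `ℤ/ℓm` are the pairs of units, `φ(m)` of them over each non-zero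
class mod `ℓ`; then part 1 §3: `Σ_{c ≠ 0} [c·t/ℓ]⁺ = −[0]⁺`). [cite: MazurTateTeitelbaum1986Invent, §I.4 (4.2)] -/
theorem sum_one_mul_ratPlusSymbol_rep_eq [NeZero ℓ] [NeZero m] {f : CuspForm (Gamma0 N) 2} (hf : IsNewform0 f)
    (hQ : coeffField f = ⊥) (hℓ : ℓ.Prime) (hℓN : ℓ ∣ N) (haℓ : cuspCoeff f ℓ = 0) (hℓm : ℓ.Coprime m)
    {t : ℕ} (ht : ¬ (ℓ : ℤ) ∣ t) :
    ∑ b : ZMod (ℓ * m), (1 : DirichletCharacter ℚ_[2] (ℓ * m)) b *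
        ((ratPlusSymbol f ((((b.val : ℤ) * t : ℤ) : ℚ) / (ℓ : ℤ)) : ℚ) : ℚ_[2]) =
      -((Nat.totient m : ℕ) : ℚ_[2]) * ((ratPlusSymbol f 0 : ℚ) : ℚ_[2]) := by
  haveI : Fact ℓ.Prime := ⟨hℓ⟩
  set G : ZMod ℓ → ℚ_[2] := fun c ↦ ((ratPlusSymbol f ((((c.val : ℤ) * t : ℤ) : ℚ) / (ℓ : ℤ)) : ℚ) : ℚ_[2]) with hG
  set e := ZMod.chineseRemainder hℓm with he
  -- rewrite the summand through the CRT coordinates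
  have hsummand : ∀ b : ZMod (ℓ * m), (1 : DirichletCharacter ℚ_[2] (ℓ * m)) b *
      ((ratPlusSymbol f ((((b.val : ℤ) * t : ℤ) : ℚ) / (ℓ : ℤ)) : ℚ) : ℚ_[2]) =
      (if IsUnit (e b).1 ∧ IsUnit (e b).2 then G (e b).1 else 0) := by
    intro b
    have h1 : (e b).1 = (ZMod.cast b : ZMod ℓ) := Prod.fst_zmod_cast b
    have hu : IsUnit b ↔ IsUnit (e b).1 ∧ IsUnit (e b).2 := by
      rw [← Prod.isUnit_iff, MulEquiv.isUnit_map]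
    by_cases hb : IsUnit b
    · rw [MulChar.one_apply hb, one_mul, if_pos (hu.mp hb), h1, hG, ratPlusSymbol_rep_eq_rep_cast f hℓ.ne_zero b t]
    · rw [MulChar.map_nonunit _ hb, zero_mul, if_neg (fun h ↦ hb (hu.mpr h))]
  rw [Finset.sum_congr rfl fun b _ ↦ hsummand b]
  rw [Fintype.sum_equiv e.toEquiv (fun b ↦ if IsUnit (e b).1 ∧ IsUnit (e b).2 then G (e b).1 else 0)
    (fun x ↦ if IsUnit x.1 ∧ IsUnit x.2 then G x.1 else 0) (fun b ↦ rfl), Fintype.sum_prod_type]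
  -- factor the double sum
  have hfac : ∀ c : ZMod ℓ, ∑ d : ZMod m, (if IsUnit c ∧ IsUnit d then G c else 0) =
      (if IsUnit c then G c else 0) * ∑ d : ZMod m, (1 : MulChar (ZMod m) ℚ_[2]) d := by
    intro c
    rw [Finset.mul_sum]
    refine Finset.sum_congr rfl fun d _ ↦ ?_
    by_cases hc : IsUnit c <;> by_cases hd : IsUnit d
    · rw [if_pos ⟨hc, hd⟩, if_pos hc, MulChar.one_apply hd, mul_one]
    · rw [if_neg (fun h ↦ hd h.2), if_pos hc, MulChar.map_nonunit _ hd, mul_zero]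
    · rw [if_neg (fun h ↦ hc h.1), if_neg hc, zero_mul]
    · rw [if_neg (fun h ↦ hc h.1), if_neg hc, zero_mul]
  simp only [hfac]
  rw [← Finset.sum_mul, MulChar.sum_one_eq_card_units, ZMod.card_units_eq_totient]
  -- the sum over `ℤ/ℓ`: units are the non-zero classes
  have hunits : ∑ c : ZMod ℓ, (if IsUnit c then G c else 0) = ∑ c ∈ (Finset.univ : Finset (ZMod ℓ)).erase 0, G c := by
    rw [← Finset.sum_erase_add _ _ (Finset.mem_univ (0 : ZMod ℓ)), if_neg not_isUnit_zero, add_zero]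
    refine Finset.sum_congr rfl fun c hc ↦ ?_
    rw [if_pos (isUnit_iff_ne_zero.mpr (Finset.ne_of_mem_erase hc))]
  have hsum : ∑ c ∈ (Finset.univ : Finset (ZMod ℓ)).erase 0, G c = -((ratPlusSymbol f 0 : ℚ) : ℚ_[2]) := by
    have h := sum_erase_ratPlusSymbol_val_mul_div_eq_neg hf hQ hℓ hℓN haℓ ht
    have h' := congrArg (fun q : ℚ ↦ (q : ℚ_[2])) h
    simp only [Rat.cast_sum, Rat.cast_neg] at h'
    rw [hG]
    convert h' using 2 with c
    push_cast; ring_nf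
  rw [hunits, hsum]
  ring

/-! ## §4 The `(χ − 𝟙)`-isotypic cell sums have norm `≤ 1` -/

/-- `‖k/2‖₂ ≤ 2` for `k ∈ ℤ`; private helper. [folklore] -/
private theorem norm_intCast_div_two_le_two (k : ℤ) : ‖((k : ℚ_[2])) / 2‖ ≤ 2 := by
  have h2 : ‖(2 : ℚ_[2])‖ = (2 : ℝ)⁻¹ := by
    have h := Padic.norm_p (p := 2)
    simpa using h
  rw [norm_div, h2, div_inv_eq_mul]
  calc ‖(k : ℚ_[2])‖ * 2 ≤ 1 * 2 := by gcongr; exact Padic.norm_int_le_one k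
    _ = 2 := one_mul _

/-- An even natural number has `2`-adic norm `≤ ‖2‖`; private helper. [folklore] -/
private theorem norm_natCast_le_of_even {k : ℕ} (hk : Even k) : ‖((k : ℕ) : ℚ_[2])‖ ≤ ‖(2 : ℚ_[2])‖ := by
  obtain ⟨j, rfl⟩ := hk
  rw [show (((j + j : ℕ)) : ℚ_[2]) = 2 * (j : ℚ_[2]) by push_cast; ring, norm_mul]
  calc ‖(2 : ℚ_[2])‖ * ‖(j : ℚ_[2])‖ ≤ ‖(2 : ℚ_[2])‖ * 1 := by
        gcongr
        have h := Padic.norm_int_le_one (p := 2) (j : ℤ)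
        rwa [Int.cast_natCast] at h
    _ = ‖(2 : ℚ_[2])‖ := mul_one _

/-- **THE ISOTYPIC CELL ESTIMATE.** For `N` odd with `ℓ² ∣ N` (`ℓ` prime), a tame level `ℓm` with `(m, 2N) = 1`, `m > 2`, a rational newform
`f` of level `N` with `a_ℓ(f) = 0`, the root `α` of `X² − a₂X + 2` with `‖α⁻¹‖ ≤ 1`, a quadratic `ℚ₂`-valued character `χ` mod `ℓm` and a unit
`h₀ ≡ 1 (mod ℓ)` with `χ(h₀) ≠ 1`: for every cell `a + 2ⁿ⁺¹ℤ₂` with `a` odd,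
`‖Σ_{b mod ℓm} (χ(b) − 𝟙_{ℓm}(b)) · μ_{f,α,ℓm}((a + 2ⁿ⁺¹ℤ₂) × {b})‖₂ ≤ 1`.
Proof: `[x_b]⁺ = [b·2ⁿ⁺¹m/ℓ]⁺ + k₁/2`, `[2x_b]⁺ = [b·2ⁿm/ℓ]⁺ + k₂/2` (§2); the `k/2`-parts carry the coefficients `χ(b) − 1` of norm `≤ ‖2‖`
(`norm_sub_one_apply_le_of_sq_eq_one`); the representatives cancel against `χ` (§3) and sum to `−φ(m)[0]⁺` against `𝟙` (§3), leaving
`φ(m)·α⁻ⁿ⁻²(α − 1)[0]⁺` with `φ(m)` even and `‖(α − 1)[0]⁺‖ ≤ 2` (`norm_sub_one_mul_ratPlusSymbol_zero_le_two`, INT2-AUTO).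
[cite: Matsuno2000, Lemma 3.2 (p. 87)] [cite: MazurTateTeitelbaum1986Invent, §I.10 (10.1)] -/
theorem norm_sum_sub_one_mul_msdMeasureTame_le_one [NeZero ℓ] [NeZero m] {f : CuspForm (Gamma0 N) 2} (hf : IsNewform0 f)
    (hQ : coeffField f = ⊥) (hℓ : ℓ.Prime) (hℓN : ℓ ^ 2 ∣ N) (h2N : ¬ 2 ∣ N) (hmN : m.Coprime N) (hm2 : ¬ 2 ∣ m)
    (hm3 : 2 < m) (haℓ : cuspCoeff f ℓ = 0) {a₂ : ℤ} (ha₂ : cuspCoeff f 2 = a₂) {α : ℚ_[2]} (hα : ‖α⁻¹‖ ≤ 1)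
    (hroot : α ^ 2 - a₂ * α + 2 = 0) (χ : DirichletCharacter ℚ_[2] (ℓ * m)) (hsq : χ ^ 2 = 1) (h₀ : (ZMod (ℓ * m))ˣ)
    (hh₀ : (ℓ : ℤ) ∣ ((h₀ : ZMod (ℓ * m)).val : ℤ) - 1) (hχ : χ h₀ ≠ 1)
    (n : ℕ) {a : ZMod (2 ^ (n + 1))} (ha : IsUnit a) :
    ‖∑ b : ZMod (ℓ * m), (χ b - (1 : DirichletCharacter ℚ_[2] (ℓ * m)) b) *
        msdMeasureTame f (ℓ * m) α (n + 1) a b‖ ≤ 1 := by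
  have hreal := cuspCoeff_im_eq_zero_of_coeffField_eq_bot hQ
  have hℓN1 : ℓ ∣ N := dvd_trans (dvd_pow_self ℓ two_ne_zero) hℓN
  have hℓm : ℓ.Coprime m := (Nat.Coprime.coprime_dvd_right hℓN1 hmN).symm
  have hα0 : α ≠ 0 := by rintro rfl; norm_num at hroot
  have hαi : ∀ j : ℕ, ‖α⁻¹ ^ j‖ ≤ 1 := fun j ↦ by rw [norm_pow]; exact pow_le_one₀ (norm_nonneg _) hα
  have h2 : ‖(2 : ℚ_[2])‖ = (2 : ℝ)⁻¹ := by
    have h := Padic.norm_p (p := 2); simpa using h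
  -- representatives and half-integers
  set t₁ : ℕ := 2 ^ (n + 1) * m with ht₁
  set t₂ : ℕ := 2 ^ n * m with ht₂
  set R₁ : ZMod (ℓ * m) → ℚ_[2] := fun b ↦ ((ratPlusSymbol f ((((b.val : ℤ) * t₁ : ℤ) : ℚ) / (ℓ : ℤ)) : ℚ) : ℚ_[2]) with hR₁
  set R₂ : ZMod (ℓ * m) → ℚ_[2] := fun b ↦ ((ratPlusSymbol f ((((b.val : ℤ) * t₂ : ℤ) : ℚ) / (ℓ : ℤ)) : ℚ) : ℚ_[2]) with hR₂
  have hK : ∀ b : ZMod (ℓ * m), ∃ k : ℤ × ℤ, IsUnit b →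
      ((ratPlusSymbol f (tameFraction 2 (ℓ * m) (n + 1) a b) : ℚ) : ℚ_[2]) = R₁ b + (k.1 : ℚ_[2]) / 2 ∧
      ((ratPlusSymbol f ((2 : ℚ) * tameFraction 2 (ℓ * m) (n + 1) a b) : ℚ) : ℚ_[2]) = R₂ b + (k.2 : ℚ_[2]) / 2 := by
    intro b
    by_cases hb : IsUnit b
    · obtain ⟨k₁, k₂, h1, h2'⟩ := exists_ratPlusSymbol_tameFraction_eq f hreal hℓ hℓN h2N hmN hm2 n ha hb
      refine ⟨(k₁, k₂), fun _ ↦ ⟨?_, ?_⟩⟩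
      · rw [h1, hR₁, ht₁]; push_cast; ring
      · rw [h2', hR₂, ht₂]; push_cast; ring
    · exact ⟨(0, 0), fun h ↦ absurd h hb⟩
  choose K hK using hK
  set w : ZMod (ℓ * m) → ℚ_[2] := fun b ↦ χ b - (1 : DirichletCharacter ℚ_[2] (ℓ * m)) b with hw
  have hw0 : ∀ b, ¬ IsUnit b → w b = 0 := fun b hb ↦ by
    rw [hw]; simp only [χ.map_nonunit hb, MulChar.map_nonunit _ hb, sub_self]
  have hwn : ∀ b, ‖w b‖ ≤ ‖(2 : ℚ_[2])‖ := fun b ↦ norm_sub_one_apply_le_of_sq_eq_one χ hsq b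
  -- the cellwise identity
  have hcell : ∀ b : ZMod (ℓ * m), w b * msdMeasureTame f (ℓ * m) α (n + 1) a b =
      w b * (α⁻¹ ^ (n + 1) * R₁ b - α⁻¹ ^ (n + 2) * R₂ b) +
        w b * (α⁻¹ ^ (n + 1) * ((K b).1 : ℚ_[2]) / 2 - α⁻¹ ^ (n + 2) * ((K b).2 : ℚ_[2]) / 2) := by
    intro b
    by_cases hb : IsUnit b
    · obtain ⟨h1, h2'⟩ := hK b hb
      unfold msdMeasureTame
      rw [show ((2 : ℕ) : ℚ) = (2 : ℚ) by norm_num, h1, h2']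
      ring
    · rw [hw0 b hb]; ring
  have hsplit : ∑ b : ZMod (ℓ * m), w b * msdMeasureTame f (ℓ * m) α (n + 1) a b =
      (α⁻¹ ^ (n + 1) * ∑ b, w b * R₁ b - α⁻¹ ^ (n + 2) * ∑ b, w b * R₂ b) +
        ∑ b, w b * (α⁻¹ ^ (n + 1) * ((K b).1 : ℚ_[2]) / 2 - α⁻¹ ^ (n + 2) * ((K b).2 : ℚ_[2]) / 2) := by
    rw [Finset.sum_congr rfl fun b _ ↦ hcell b, Finset.sum_add_distrib, Finset.mul_sum, Finset.mul_sum,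
      ← Finset.sum_sub_distrib]
    congr 1
    refine Finset.sum_congr rfl fun b _ ↦ ?_
    ring
  -- the representative sums
  have hℓ2 : ℓ ≠ 2 := by rintro rfl; exact h2N (dvd_trans ⟨2, by norm_num⟩ hℓN)
  have hndvd : ∀ k : ℕ, ¬ (ℓ : ℤ) ∣ ((2 ^ k * m : ℕ) : ℤ) := by
    intro k h
    have h' : ℓ ∣ 2 ^ k * m := Int.natCast_dvd_natCast.mp h
    rcases (Nat.Prime.dvd_mul hℓ).mp h' with h1 | h1
    · exact hℓ2 ((Nat.prime_dvd_prime_iff_eq hℓ Nat.prime_two).mp (hℓ.dvd_of_dvd_pow h1))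
    · exact (Nat.Prime.coprime_iff_not_dvd hℓ).mp hℓm h1
  have ht₁ℓ : ¬ (ℓ : ℤ) ∣ (t₁ : ℕ) := hndvd (n + 1)
  have ht₂ℓ : ¬ (ℓ : ℤ) ∣ (t₂ : ℕ) := hndvd n
  have hWR : ∀ {t : ℕ}, ¬ (ℓ : ℤ) ∣ (t : ℕ) →
      ∑ b : ZMod (ℓ * m), w b * ((ratPlusSymbol f ((((b.val : ℤ) * t : ℤ) : ℚ) / (ℓ : ℤ)) : ℚ) : ℚ_[2]) =
        ((Nat.totient m : ℕ) : ℚ_[2]) * ((ratPlusSymbol f 0 : ℚ) : ℚ_[2]) := by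
    intro t ht
    simp only [hw, sub_mul, Finset.sum_sub_distrib]
    rw [sum_char_mul_ratPlusSymbol_rep_eq_zero f hℓ.ne_zero χ h₀ hh₀ hχ t,
      sum_one_mul_ratPlusSymbol_rep_eq hf hQ hℓ hℓN1 haℓ hℓm ht]
    ring
  have hrep : α⁻¹ ^ (n + 1) * ∑ b, w b * R₁ b - α⁻¹ ^ (n + 2) * ∑ b, w b * R₂ b =
      ((Nat.totient m : ℕ) : ℚ_[2]) * (α⁻¹ ^ (n + 2) * ((α - 1) * ((ratPlusSymbol f 0 : ℚ) : ℚ_[2]))) := by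
    rw [hR₁, hR₂, hWR ht₁ℓ, hWR ht₂ℓ]
    have hαα : α⁻¹ ^ (n + 2) * α = α⁻¹ ^ (n + 1) := by
      rw [pow_succ, mul_assoc, inv_mul_cancel₀ hα0, mul_one]
    linear_combination (-(((Nat.totient m : ℕ) : ℚ_[2]) * ((ratPlusSymbol f 0 : ℚ) : ℚ_[2]))) * hαα
  -- norms
  have hε := norm_sub_one_mul_ratPlusSymbol_zero_le_two hf hreal h2N ha₂ hα hroot
  have hφ : ‖((Nat.totient m : ℕ) : ℚ_[2])‖ ≤ ‖(2 : ℚ_[2])‖ := norm_natCast_le_of_even (Nat.totient_even hm3)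
  have hA : ‖α⁻¹ ^ (n + 1) * ∑ b, w b * R₁ b - α⁻¹ ^ (n + 2) * ∑ b, w b * R₂ b‖ ≤ 1 := by
    rw [hrep, norm_mul, norm_mul]
    calc ‖((Nat.totient m : ℕ) : ℚ_[2])‖ * (‖α⁻¹ ^ (n + 2)‖ * ‖(α - 1) * ((ratPlusSymbol f 0 : ℚ) : ℚ_[2])‖)
        ≤ ‖(2 : ℚ_[2])‖ * (1 * 2) := by gcongr; exact hαi _
      _ = 1 := by rw [h2]; norm_num
  have hB : ‖∑ b : ZMod (ℓ * m), w b * (α⁻¹ ^ (n + 1) * ((K b).1 : ℚ_[2]) / 2 - α⁻¹ ^ (n + 2) * ((K b).2 : ℚ_[2]) / 2)‖ ≤ 1 := by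
    refine IsUltrametricDist.norm_sum_le_of_forall_le_of_nonneg zero_le_one fun b _ ↦ ?_
    rw [norm_mul]
    have hin : ‖α⁻¹ ^ (n + 1) * ((K b).1 : ℚ_[2]) / 2 - α⁻¹ ^ (n + 2) * ((K b).2 : ℚ_[2]) / 2‖ ≤ 2 := by
      rw [sub_eq_add_neg]
      refine (Padic.nonarchimedean _ _).trans (max_le ?_ ?_)
      · rw [mul_div_assoc, norm_mul]
        calc _ ≤ 1 * 2 := mul_le_mul (hαi _) (norm_intCast_div_two_le_two _) (norm_nonneg _) zero_le_one
          _ = 2 := one_mul _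
      · rw [norm_neg, mul_div_assoc, norm_mul]
        calc _ ≤ 1 * 2 := mul_le_mul (hαi _) (norm_intCast_div_two_le_two _) (norm_nonneg _) zero_le_one
          _ = 2 := one_mul _
    calc ‖w b‖ * ‖α⁻¹ ^ (n + 1) * ((K b).1 : ℚ_[2]) / 2 - α⁻¹ ^ (n + 2) * ((K b).2 : ℚ_[2]) / 2‖
        ≤ ‖(2 : ℚ_[2])‖ * 2 := mul_le_mul (hwn b) hin (norm_nonneg _) (norm_nonneg _)
      _ = 1 := by rw [h2]; norm_num
  rw [hsplit]
  exact (Padic.nonarchimedean _ _).trans (max_le hA hB)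

end Summit.BirchSwinnertonDyer.BirchSwinnertonDyer.Theorems.AlignedTransportAtTwoBothAddMeasure

end
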